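import Summits.HodgeConjecture.CorCM.MultiFieldWeilSimpleFamiliesStandalone
import Summits.HodgeConjecture.CorCM.MultiFieldWeilForeignCurves
import HarnessLib

/-!
# MULTI-FIELD WEIL ENGINE — ANY CM ELLIPTIC CURVE WITH A TOWER FAMILY OF SIMPLE CM THREEFOLDS: the Hodge conjecture for every `E′^a × ∏_m T_m^{b_m}`, given
# ONLY Markman's fourfold theorem — whatever the curve's CM field

Cell `pub-hodgecm2` (COR-CM), seat b30 gen 33 (2026-08-24); count-neutral own lane MULTI-FIELD WEIL ENGINE (stem `MultiFieldWeil*`), sequel of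
`CorCM/MultiFieldWeilSimpleFamiliesStandalone.lean` (the reader's form of the tower headline: `k`, `K : Fin r → Type`, simple threefolds `T : Fin r → AbelianVariety ℂ`)
and `CorCM/MultiFieldWeilForeignCurves.lean` (foreign CM elliptic curves join for free).  Theorems only; no definition, no named fact, no `sorry`.  HONEST FRAMING:
conditional on the displayed Markman fourfold binder only; `HC_CM` is NOT proved and not asserted.

THE STATEMENT (**`hodgeConjectureFor_biproduct_cons_anyCurve_simpleThreefolds_of_cubicTower`**).  `k` imaginary quadratic; `K_0, …, K_{r−1}` sextic CM fields with
`i_m : k → K_m`; `T_m ⊨ (K_m; Φ_m)` SIMPLE abelian threefolds; the cubic-tower condition for one embedding `τ` of `k` and one family `s_m ⊃ τ` of embeddings; and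
`E′ ⊨ (k′; Ψ′)` ANY CM elliptic curve — nothing assumed on `k′`.  Then for every `κ : Fin N → Fin (r + 1)` the Hodge conjecture holds for `⨁_j (Fin.cons E′ T) (κ j)` —
EVERY `E′^a × T_0^{b_0} × ⋯ × T_{r−1}^{b_{r−1}}` — GIVEN ONLY `Markman2025_weilClasses_algebraic_abelianFourfold`.
* `k′ ≅ k`: `E′` carries a `k`-structure of type `{τ}` (transport along `k′ ≅ k`, then along complex conjugation of `k` if needed — `exists_realisation_iff_eq_of_ringEquiv`),
  and the engine form `hodgeConjectureFor_biproduct_comp_of_simpleThreefolds_of_cubicTower` (`CorCM/MultiFieldWeilSimpleFamilies.lean`) applies with `E′` in the curve slot.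
* `k′ ≄ k`: `k′` embeds in NO `K_m` (a sextic field through `k` has no other quadratic subfield — seat b16's `WeilFibre.nonempty_algEquiv_of_finrank_eq_two`), so `E′` is
  FOREIGN and `hodgeConjectureFor_prod_of_foreignCurves` glues its powers to the curve-free tower theorem `hodgeConjectureFor_biproduct_simpleThreefolds_of_cubicTower`.

[cite: Markman2025SurveySecant, Thm. 1.2] [cite: MoonenZarhin1999LowDim, §3 (3.1), Cor. (3.9), §5 (5.2)] [cite: Shimura1998, §6.2 Thm. 3, §8.2 Prop. 26, §8.4, §18.2 Lemma (i)]
[cite: Lang2002, VI §1 Thm. 1.1, Cor. 1.6 and V §2 Thm. 2.8]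

## References
* [Markman2025SurveySecant] E. Markman, arXiv:2509.23403, Thm. 1.2.  [MoonenZarhin1999LowDim] B. Moonen, Yu. Zarhin, Math. Ann. 315 (1999) 711–733.  [Shimura1998]
  G. Shimura, *Abelian varieties with complex multiplication and modular functions*, §6.2, §8.2, §8.4, §18.2.  [Lang2002] S. Lang, *Algebra*, GTM 211, V §2, VI §1.
-/

noncomputable section

open CategoryTheory CategoryTheory.Limits NumberField IntermediateField

namespace Summit.HodgeConjecture.CorCM.MultiFieldWeil

open Finset
open Literature.AlgebraicGeometry Literature.AlgebraicGeometry.Motives Literature.AlgebraicGeometry.HodgeTheory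
open Literature.AlgebraicGeometry.ComplexMultiplication (IsCMTypeRealisation)
open Literature.AlgebraicTopology.SingularHomology
open Literature.NumberTheory.ComplexMultiplication

open scoped Classical

/-! ## §1 A CM elliptic curve whose field is isomorphic to `k` carries a `k`-structure of type `{τ}` -/

section Transport

variable {k k' : Type} [Field k] [NumberField k] [IsCMField k] [Field k'] [NumberField k'] [IsCMField k']
  {E' : AbelianVariety ℂ} {Ψ' : CMType k'} {ιE' : 𝓞 k' →+* End E'} {θE' : k' →+* Module.End ℂ (complexBetti E'.X 1)}

omit [IsCMField k'] in
/-- **A CM elliptic curve with CM field `k′ ≅ k` realises the type `{τ}` of `k`**, for every embedding `τ` of the imaginary quadratic field `k`: transport the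
structure along `e : k′ ≃ k`; the transported type is `{τ}` or `{τ̄}`, and in the second case transport once more along complex conjugation of `k` (same variety).
[cite: Shimura1998, §18.2 Lemma (i)] -/
theorem exists_realisation_iff_eq_of_ringEquiv (h2 : Module.finrank ℚ k = 2) (e : k' ≃+* k) (hE' : IsCMTypeRealisation Ψ' E' ιE' θE') (τ : k →+* ℂ) :
    ∃ (Ψ : CMType k) (ι : 𝓞 k →+* End E') (θ : k →+* Module.End ℂ (complexBetti E'.X 1)), IsCMTypeRealisation Ψ E' ι θ ∧ ∀ σ : k →+* ℂ, σ ∈ Ψ.1 ↔ σ = τ := by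
  have hττ : ComplexEmbedding.conjugate τ ≠ τ := QuarticCM.conjugate_ne τ
  have hk : ∀ σ : k →+* ℂ, σ = τ ∨ σ = ComplexEmbedding.conjugate τ := fun σ => QuarticCM.eq_or_eq_conjugate_of_quadratic h2 τ σ
  -- a `k`-structure whose type contains `τ` suffices
  suffices H : ∃ (Ψ : CMType k) (ι : 𝓞 k →+* End E') (θ : k →+* Module.End ℂ (complexBetti E'.X 1)), IsCMTypeRealisation Ψ E' ι θ ∧ τ ∈ Ψ.1 by
    obtain ⟨Ψ, ι, θ, hE, hτΨ⟩ := H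
    refine ⟨Ψ, ι, θ, hE, fun σ => ?_⟩
    rcases hk σ with rfl | rfl
    · exact ⟨fun _ => rfl, fun _ => hτΨ⟩
    · exact ⟨fun h => absurd h ((Ψ.2 τ).1 hτΨ), fun h => absurd h hττ⟩
  have hT := hE'.transport e
  obtain ⟨σ, hσ⟩ := exists_mem_cmType (Literature.NumberTheory.Automorphic.PicardCM.CMCode.cmTypeMap e Ψ')
  rcases hk σ with rfl | rfl
  · exact ⟨_, _, _, hT, hσ⟩
  · -- the type contains `τ̄`: pass to the conjugate structure, whose type contains `τ̄̄ = τ`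
    refine ⟨_, _, _, hT.transport (IsCMField.complexConj k).toRingEquiv, ?_⟩
    rw [Literature.NumberTheory.Automorphic.PicardCM.CMCode.mem_cmTypeMap_iff]
    have hcomp : τ.comp (IsCMField.complexConj k).toRingEquiv.toRingHom = ComplexEmbedding.conjugate τ := by
      refine RingHom.ext fun x => ?_
      change τ (IsCMField.complexConj k x) = starRingEnd ℂ (τ x)
      exact IsCMField.complexEmbedding_complexConj k τ x
    rw [hcomp]
    exact hσ

end Transport

/-! ## §2 Any CM elliptic curve with a cubic tower of simple CM threefolds -/

section AnyCurve

variable {r : ℕ} {k k' : Type} [fk : Field k] [nk : NumberField k] [ck : IsCMField k] [Field k'] [NumberField k'] [IsCMField k']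
  {K : Fin r → Type} [fK : ∀ m, Field (K m)] [nK : ∀ m, NumberField (K m)] [cK : ∀ m, IsCMField (K m)]
  {T : Fin r → AbelianVariety ℂ} {Φ : ∀ m : Fin r, CMType (K m)} {ι : ∀ m, 𝓞 (K m) →+* End (T m)} {θ : ∀ m, K m →+* Module.End ℂ (complexBetti (T m).X 1)}
  {E' : AbelianVariety ℂ} {Ψ' : CMType k'} {ιE' : 𝓞 k' →+* End E'} {θE' : k' →+* Module.End ℂ (complexBetti E'.X 1)} {N : ℕ}

omit nK cK in
/-- The slots `≥ 1` of `Fin.cons E′ T` are the threefolds: `(Fin.cons E′ T) i = T (i.pred _)` for `i ≠ 0` (bookkeeping). [folklore] -/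
theorem cons_apply_of_ne_zero (i : Fin (r + 1)) (hi : i ≠ 0) : (Fin.cons E' T : Fin (r + 1) → AbelianVariety ℂ) i = T (i.pred hi) := by
  cases i using Fin.cases with
  | zero => exact absurd rfl hi
  | succ m => simp only [Fin.cons_succ, Fin.pred_succ]

/-- **ANY CM ELLIPTIC CURVE WITH A CUBIC TOWER OF SIMPLE CM THREEFOLDS — given ONLY Markman's fourfold theorem.**  `k` imaginary quadratic; `K_0, …, K_{r−1}` sextic
CM fields with `i_m : k → K_m`; `T_m ⊨ (K_m; Φ_m)` SIMPLE abelian threefolds; `τ` an embedding of `k` and `s_m ⊃ τ` embeddings with the cubic-tower condition (no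
embedding of `K_m` over `τ` takes its values in `ℚ(τk) · s_0(K_0) ⋯ s_{m−1}(K_{m−1})`); and `E′ ⊨ (k′; Ψ′)` ANY CM elliptic curve — NOTHING assumed on `k′`.  Then for
every `κ : Fin N → Fin (r + 1)` the Hodge conjecture holds for `⨁_j (Fin.cons E′ T) (κ j)` — every `E′^a × ∏_m T_m^{b_m}` — GIVEN ONLY
`Markman2025_weilClasses_algebraic_abelianFourfold`.  (`k′ ≅ k`: `E′` takes the curve slot of the engine, §1; `k′ ≄ k`: `E′` is foreign to every `K_m` — a sextic
field through `k` has no second quadratic subfield — and joins for free.)  `HC_CM` is NOT asserted. [cite: Markman2025SurveySecant, Thm. 1.2]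
[cite: MoonenZarhin1999LowDim, §3 (3.1), Cor. (3.9), §5 (5.2)] [cite: Shimura1998, §8.2 Prop. 26, §8.4, §18.2 Lemma (i)] [cite: Lang2002, VI §1 Thm. 1.1, Cor. 1.6 and V §2 Thm. 2.8] -/
theorem hodgeConjectureFor_biproduct_cons_anyCurve_simpleThreefolds_of_cubicTower (hW4 : Markman2025_weilClasses_algebraic_abelianFourfold)
    (κ : Fin N → Fin (r + 1)) (h2 : Module.finrank ℚ k = 2) (h6 : ∀ m, Module.finrank ℚ (K m) = 6) (i : ∀ m, k →+* K m)
    (hT : ∀ m, IsCMTypeRealisation (Φ m) (T m) (ι m) (θ m)) (hS : ∀ m, (T m).IsSimple)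
    (τ : k →+* ℂ) (s : ∀ m, K m →+* ℂ) (hs : ∀ m, (s m).comp (i m) = τ)
    (htower : ∀ (m : Fin r) (φ : K m →+* ℂ), φ.comp (i m) = τ →
      ¬ Set.range φ ⊆ (↑(adjoin ℚ (Set.range τ) ⊔ adjoin ℚ (⋃ j : {j : Fin r // j < m}, Set.range (s j.1))) : Set ℂ))
    (h2' : Module.finrank ℚ k' = 2) (hE' : IsCMTypeRealisation Ψ' E' ιE' θE') :
    HodgeConjectureFor (⨁ fun j => (Fin.cons E' T : Fin (r + 1) → AbelianVariety ℂ) (κ j)).dim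
      (⨁ fun j => (Fin.cons E' T : Fin (r + 1) → AbelianVariety ℂ) (κ j)).X := by
  by_cases hkk : Nonempty (k' →+* k)
  · -- `k' ≅ k`: `E'` in the curve slot of the engine, over the family of fields `Fin.cons k K`
    obtain ⟨f⟩ := hkk
    obtain ⟨e⟩ := exists_ringEquiv_of_ringHom_of_finrank_eq f (h2'.trans h2.symm)
    obtain ⟨Ψ, ιE, θE, hE, hΨ⟩ := exists_realisation_iff_eq_of_ringEquiv h2 e hE' τ
    let Kf : Fin (r + 1) → Type := Fin.cons k K
    letI instF : ∀ j, Field (Kf j) := Fin.cases fk fun m => fK m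
    letI instN : ∀ j, NumberField (Kf j) := Fin.cases nk fun m => nK m
    haveI instC : ∀ j, IsCMField (Kf j) := Fin.cases ck fun m => cK m
    obtain ⟨Φf, ιf, θf, hA, h0, -⟩ :=
      @exists_realisations_cons (Fin (r + 1)) r Kf instF instN 0 Fin.succ T Φ ι θ Ψ E' ιE θE hE hT
    have hΨ' : ∀ σ : k →+* ℂ, σ ∈ (Φf 0).1 ↔ σ = τ := by rw [h0]; exact hΨ
    exact @hodgeConjectureFor_biproduct_comp_of_simpleThreefolds_of_cubicTower (Fin (r + 1)) r Kf instF instN instC 0 Fin.succ τ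
      (Fin.cons E' T) Φf ιf θf hW4 N κ h2 h6 i hA hΨ' (fun m => hS m) s hs htower
  · -- `k' ≄ k`: `E'` is foreign to every `K_m`
    rw [not_nonempty_iff] at hkk
    have hfor : ∀ m, IsEmpty (k' →+* K m) := fun m => ⟨fun g => by
      obtain ⟨e⟩ := WeilFibre.nonempty_algEquiv_of_finrank_eq_two (M := K m) h2' h2 (by rw [h6 m]; decide) g.toRatAlgHom (i m).toRatAlgHom
      exact hkk.false e.toRingEquiv.toRingHom⟩
    -- the family `Fin.cons E' T` over the fields `Fin.cons k' K`, with its realisation data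
    let Kf : Fin (r + 1) → Type := Fin.cons k' K
    letI instF : ∀ j, Field (Kf j) := Fin.cases ‹Field k'› fun m => fK m
    letI instN : ∀ j, NumberField (Kf j) := Fin.cases ‹NumberField k'› fun m => nK m
    haveI instC : ∀ j, IsCMField (Kf j) := Fin.cases ‹IsCMField k'› fun m => cK m
    -- no threefold at all: powers of `E'`
    rcases isEmpty_or_nonempty (Fin r) with hr | ⟨⟨m₀⟩⟩
    · have hκ : ∀ j, κ j = 0 := fun j => Fin.cases rfl (fun m => isEmptyElim m) (κ j)
      have hfun : (fun j => (Fin.cons E' T : Fin (r + 1) → AbelianVariety ℂ) (κ j)) = fun _ => E' := funext fun j => by rw [hκ j]; rfl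
      rw [hfun]
      exact hodgeConjectureFor_biproduct_const_of_cmCurve h2' hE' N
    obtain ⟨Φf, ιf, θf, hA, h0, -⟩ :=
      @exists_realisations_cons (Fin (r + 1)) r Kf instF instN 0 Fin.succ T Φ ι θ Ψ' E' ιE' θE' hE' hT
    refine @hodgeConjectureFor_prod_of_foreignCurves (Fin (r + 1)) _ (fun j => Kf (mfSlots (0 : Fin (r + 1)) Fin.succ j)) _ _ _ Φf
      (Fin.cons E' T) ιf θf hA (fun j => j = 0) _ ?_ ?_ ⟨0, rfl⟩ ⟨m₀.succ, Fin.succ_ne_zero m₀⟩ ?_ ?_ N κ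
    · intro a ha
      subst ha
      exact h2'
    · intro a j ha hj
      subst ha
      cases j using Fin.cases with
      | zero => exact absurd rfl hj
      | succ m => exact hfor m
    · intro M ρ hρ
      have hfun : (fun l => (Fin.cons E' T : Fin (r + 1) → AbelianVariety ℂ) (ρ l)) = fun _ => E' := funext fun l => by rw [hρ l]; rfl
      rw [hfun]
      exact hodgeConjectureFor_biproduct_const_of_cmCurve h2' hE' M
    · intro M ρ hρ
      have hfun : (fun l => (Fin.cons E' T : Fin (r + 1) → AbelianVariety ℂ) (ρ l)) = fun l => T ((ρ l).pred (hρ l)) :=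
        funext fun l => cons_apply_of_ne_zero (ρ l) (hρ l)
      rw [hfun]
      exact hodgeConjectureFor_biproduct_simpleThreefolds_of_cubicTower hW4 (fun l => (ρ l).pred (hρ l)) h2 h6 i hT hS τ s hs htower

end AnyCurve

end Summit.HodgeConjecture.CorCM.MultiFieldWeil

end
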